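import Mathlib
import HarnessLib

/-!
# `HeteroclinicTriggerChain` — crux `TriggerChainFrontStep` (item stmt-NavierStokesRegularity-22785):
  the FORCED transfer arc — radius drift, no re-loading, capture, trigger decay

Blueprint item 2 (hop map), robust form. After ignition the hop of the trigger chain is governed, in the
reduced variables `D = x − y` (carrier minus receiver) and `u` (trigger), by
`D′ = −2e·u² + f₁`, `u′ = e·D·u + f₂`,
where `f₁, f₂` collect everything that is not the complete-transfer arc (`g = e`): the seed work `−βuv`,
the upper drain `e′v²`, and — on the full lattice — the junk, tail and `βσ` remainders. Without forcing
`D² + 2u²` is conserved and the motion is the explicit heteroclinic half-turn from `D = ρ` (all carrier) to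
`D = −ρ` (all receiver). With forcing of size `≤ φ` on a window `[0,T]` (and a priori `|D|, |u| ≤ M` there)
we prove, by barrier/fencing arguments only (no ODE uniqueness, no closed form):

* `heteroclinicTriggerChain_forcedArc_radius_drift` — `|D(t)² + 2u(t)² − (D(0)² + 2u(0)²)| ≤ 6Mφ·t`
  (the `e`-terms cancel exactly);
* `heteroclinicTriggerChain_forcedArc_no_reload` — once ignited (`2u(0)² > 6MφT + φ/e`) the carrier
  surplus never exceeds its initial value: `D(t) ≤ D(0)` on `[0,T]`;
* `heteroclinicTriggerChain_forcedArc_capture` — CAPTURE: if `2u(0)² ≥ 2m + 6MφT`,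
  `L² + 2m + 6MφT ≤ D(0)² + 2u(0)²` and `φ < 2em`, then `D ≤ −L` is reached within time
  `(D(0) + L)/(2em − φ)` (the trigger keeps energy `≥ m` until capture, so `D` falls at rate `≥ 2em − φ`);
* `heteroclinicTriggerChain_forcedArc_trigger_decay` — after capture, while `D ≤ −L < 0`, the trigger
  decays: `|u(t)| ≤ |u(s)|·e^{−eL(t−s)} + φ/(eL)`;
* `heteroclinicTriggerChain_trunc_capture` — the corollary for the lead's seeded two-shell truncation
  (`x′ = −eu² − βuv`, `u′ = exu − euy`, `y′ = eu² − e′v²`, `v′ = βxu + e′yv`): `f₂ = 0`,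
  `f₁ = −βuv + e′v²`, so with `|u| ≤ M`, `|v| ≤ V` on the window the forcing is `φ = βMV + e′V²`.

HONEST FRAMING: elementary real analysis of a planar quadratic ODE with bounded forcing; helper lemmas for
the crux (no stub credit); nothing here is a statement about the Navier–Stokes equations; no summit, rung
or crux is proved by this file.
-/

noncomputable section

set_option linter.dupNamespace false

open Real Set

namespace Summit.NavierStokesRegularity.NavierStokesRegularity.Theorems

/-- **Radius drift of the forced arc.** If `D′ = −2eu² + f₁`, `u′ = eDu + f₂` with `|f₁|, |f₂| ≤ φ` and
`|D|, |u| ≤ M` on `[0,T]`, then the arc radius `Q = D² + 2u²` (conserved without forcing) drifts at most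
linearly: `|Q(t) − Q(0)| ≤ 6Mφ·t` for `t ∈ [0,T]`. [folklore] -/
theorem heteroclinicTriggerChain_forcedArc_radius_drift {e φ M T : ℝ} {D u f₁ f₂ : ℝ → ℝ}
    (hD : ∀ t, HasDerivAt D (-(2 * e * u t ^ 2) + f₁ t) t)
    (hu : ∀ t, HasDerivAt u (e * D t * u t + f₂ t) t)
    (hf₁ : ∀ t ∈ Icc 0 T, |f₁ t| ≤ φ) (hf₂ : ∀ t ∈ Icc 0 T, |f₂ t| ≤ φ)
    (hDM : ∀ t ∈ Icc 0 T, |D t| ≤ M) (huM : ∀ t ∈ Icc 0 T, |u t| ≤ M) :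
    ∀ t ∈ Icc 0 T, |(D t ^ 2 + 2 * u t ^ 2) - (D 0 ^ 2 + 2 * u 0 ^ 2)| ≤ 6 * M * φ * t := by
  -- the radius and its derivative (the `e`-terms cancel)
  have hQ : ∀ t, HasDerivAt (fun s => D s ^ 2 + 2 * u s ^ 2) (2 * D t * f₁ t + 4 * u t * f₂ t) t := by
    intro t
    have h := ((hD t).pow 2).add (((hu t).pow 2).const_mul 2)
    refine h.congr_deriv ?_
    push_cast
    ring
  intro t ht
  have hbound : ∀ s ∈ Ico 0 T, ‖2 * D s * f₁ s + 4 * u s * f₂ s‖ ≤ 6 * M * φ := by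
    intro s hs
    have hs' : s ∈ Icc 0 T := Ico_subset_Icc_self hs
    have h1 : |D s * f₁ s| ≤ M * φ := by
      rw [abs_mul]; exact mul_le_mul (hDM s hs') (hf₁ s hs') (abs_nonneg _) ((abs_nonneg _).trans (hDM s hs'))
    have h2 : |u s * f₂ s| ≤ M * φ := by
      rw [abs_mul]; exact mul_le_mul (huM s hs') (hf₂ s hs') (abs_nonneg _) ((abs_nonneg _).trans (huM s hs'))
    rw [Real.norm_eq_abs]
    calc |2 * D s * f₁ s + 4 * u s * f₂ s| ≤ |2 * D s * f₁ s| + |4 * u s * f₂ s| := abs_add_le _ _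
      _ = 2 * |D s * f₁ s| + 4 * |u s * f₂ s| := by
          rw [mul_assoc, mul_assoc, abs_mul, abs_mul]; norm_num
      _ ≤ 2 * (M * φ) + 4 * (M * φ) := by linarith
      _ = 6 * M * φ := by ring
  have h := norm_image_sub_le_of_norm_deriv_right_le_segment
    (fun s _ => (hQ s).continuousAt.continuousWithinAt)
    (fun s _ => (hQ s).hasDerivWithinAt) hbound t ht
  simpa [Real.norm_eq_abs] using h

/-- **No re-loading after ignition.** In the setting of `heteroclinicTriggerChain_forcedArc_radius_drift`
with `e > 0`: if the trigger is ignited, `2u(0)² > 6MφT + φ/e` (its energy beats the radius drift and the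
forcing), then the carrier surplus never exceeds its initial value on the window: `D(t) ≤ D(0)` for
`t ∈ [0,T]` (at any return to the level `D(0)` the radius bound forces `u² > φ/(2e)`, hence `D′ < 0`:
a fencing argument). [folklore] -/
theorem heteroclinicTriggerChain_forcedArc_no_reload {e φ M T : ℝ} {D u f₁ f₂ : ℝ → ℝ} (he : 0 < e)
    (hD : ∀ t, HasDerivAt D (-(2 * e * u t ^ 2) + f₁ t) t)
    (hu : ∀ t, HasDerivAt u (e * D t * u t + f₂ t) t)
    (hf₁ : ∀ t ∈ Icc 0 T, |f₁ t| ≤ φ) (hf₂ : ∀ t ∈ Icc 0 T, |f₂ t| ≤ φ)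
    (hDM : ∀ t ∈ Icc 0 T, |D t| ≤ M) (huM : ∀ t ∈ Icc 0 T, |u t| ≤ M)
    (hign : 6 * M * φ * T + φ / e < 2 * u 0 ^ 2) :
    ∀ t ∈ Icc 0 T, D t ≤ D 0 := by
  have hdrift := heteroclinicTriggerChain_forcedArc_radius_drift hD hu hf₁ hf₂ hDM huM
  intro t ht
  refine image_le_of_deriv_right_lt_deriv_boundary (f := D) (B := fun _ => D 0) (B' := fun _ => 0)
    (a := 0) (b := T) (fun s _ => (hD s).continuousAt.continuousWithinAt)
    (fun s _ => (hD s).hasDerivWithinAt) le_rfl (fun s => hasDerivAt_const s (D 0)) ?_ ht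
  intro s hs hDs
  have hs' : s ∈ Icc 0 T := Ico_subset_Icc_self hs
  -- radius at time s versus time 0
  have hq := (abs_le.1 (hdrift s hs')).1
  rw [hDs] at hq
  -- 2 u(s)² ≥ 2 u(0)² − 6 M φ s ≥ 2 u(0)² − 6 M φ T > φ / e
  have hφ : 0 ≤ φ := (abs_nonneg _).trans (hf₁ s hs')
  have hM : 0 ≤ M := (abs_nonneg _).trans (hDM s hs')
  have hsT : 6 * M * φ * s ≤ 6 * M * φ * T := by
    have := hs.2.le; have h6 : 0 ≤ 6 * M * φ := by positivity
    exact mul_le_mul_of_nonneg_left this h6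
  have hus : φ / e < 2 * u s ^ 2 := by linarith
  have hus' : φ < 2 * e * u s ^ 2 := by
    rw [div_lt_iff₀ he] at hus; linarith
  have hf := (abs_le.1 (hf₁ s hs')).2
  show -(2 * e * u s ^ 2) + f₁ s < 0
  linarith

/-- **CAPTURE of the forced arc.** In the setting of `heteroclinicTriggerChain_forcedArc_radius_drift` with
`e > 0`, let `m, L` be such that the trigger energy at time `0` and the capture level both fit inside the
drifting radius: `2m + 6MφT ≤ 2u(0)²`, `L² + 2m + 6MφT ≤ D(0)² + 2u(0)²`, and the forcing is dominated,
`φ < 2em`. If the window is long enough, `(D(0)+L)/(2em − φ) ≤ T`, then the receiver captures the energy: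
`D(t) ≤ −L` for some `t ∈ [0, max 0 ((D(0)+L)/(2em − φ))]` (until capture the trigger keeps energy
`u² ≥ m`, so `D` decreases at rate at least `2em − φ`). [folklore] -/
theorem heteroclinicTriggerChain_forcedArc_capture {e φ M T : ℝ} {D u f₁ f₂ : ℝ → ℝ} (he : 0 < e)
    (hT : 0 ≤ T)
    (hD : ∀ t, HasDerivAt D (-(2 * e * u t ^ 2) + f₁ t) t)
    (hu : ∀ t, HasDerivAt u (e * D t * u t + f₂ t) t)
    (hf₁ : ∀ t ∈ Icc 0 T, |f₁ t| ≤ φ) (hf₂ : ∀ t ∈ Icc 0 T, |f₂ t| ≤ φ)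
    (hDM : ∀ t ∈ Icc 0 T, |D t| ≤ M) (huM : ∀ t ∈ Icc 0 T, |u t| ≤ M)
    {m L : ℝ} (hφm : φ < 2 * e * m) (hu0 : 2 * m + 6 * M * φ * T ≤ 2 * u 0 ^ 2)
    (hL : L ^ 2 + 2 * m + 6 * M * φ * T ≤ D 0 ^ 2 + 2 * u 0 ^ 2)
    (hTT : (D 0 + L) / (2 * e * m - φ) ≤ T) :
    ∃ t ∈ Icc 0 (max 0 ((D 0 + L) / (2 * e * m - φ))), D t ≤ -L := by
  set T₁ : ℝ := max 0 ((D 0 + L) / (2 * e * m - φ))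
  have hT₁0 : 0 ≤ T₁ := le_max_left _ _
  have hT₁T : T₁ ≤ T := max_le hT hTT
  have hγ : 0 < 2 * e * m - φ := by linarith
  have hφ : 0 ≤ φ := (abs_nonneg _).trans (hf₁ 0 ⟨le_rfl, hT⟩)
  have hM : 0 ≤ M := (abs_nonneg _).trans (hDM 0 ⟨le_rfl, hT⟩)
  have hdrift := heteroclinicTriggerChain_forcedArc_radius_drift hD hu hf₁ hf₂ hDM huM
  -- no re-loading: D ≤ D 0 on [0, T]
  have hm0 : φ / e < 2 * m := by rw [div_lt_iff₀ he]; linarith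
  have hreload := heteroclinicTriggerChain_forcedArc_no_reload he hD hu hf₁ hf₂ hDM huM (by linarith)
  by_contra hcon
  push Not at hcon
  -- on [0, T₁] the trigger keeps energy ≥ m, so D' ≤ -(2em - φ)
  have hderiv : ∀ s ∈ Ico 0 T₁, -(2 * e * u s ^ 2) + f₁ s ≤ -(2 * e * m - φ) := by
    intro s hs
    have hs₁ : s ∈ Icc 0 T₁ := Ico_subset_Icc_self hs
    have hs' : s ∈ Icc 0 T := ⟨hs.1, hs.2.le.trans hT₁T⟩
    have h1 : -L < D s := hcon s hs₁
    have h2 : D s ≤ D 0 := hreload s hs'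
    have hq := (abs_le.1 (hdrift s hs')).1
    have hsT : 6 * M * φ * s ≤ 6 * M * φ * T := by
      have h6 : 0 ≤ 6 * M * φ := by positivity
      exact mul_le_mul_of_nonneg_left hs'.2 h6
    -- D s ^ 2 ≤ max (D 0 ^ 2) (L ^ 2), by cases on the sign of D s
    have hsq : 2 * m ≤ 2 * u s ^ 2 := by
      rcases le_or_gt 0 (D s) with hpos | hneg
      · have : D s ^ 2 ≤ D 0 ^ 2 := by nlinarith
        nlinarith
      · have : D s ^ 2 ≤ L ^ 2 := by nlinarith
        nlinarith
    have hf := (abs_le.1 (hf₁ s hs')).2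
    nlinarith
  -- fence D by the line D 0 - (2em - φ) s on [0, T₁]
  have hline := image_le_of_deriv_right_le_deriv_boundary (f := D) (a := 0) (b := T₁)
    (B := fun s => D 0 - (2 * e * m - φ) * s) (B' := fun _ => -(2 * e * m - φ))
    (fun s _ => (hD s).continuousAt.continuousWithinAt) (fun s _ => (hD s).hasDerivWithinAt)
    (by simp) (by fun_prop)
    (fun s _ => by
      have h := ((hasDerivAt_id s).const_mul (2 * e * m - φ)).const_sub (D 0)
      simpa using h.hasDerivWithinAt)
    hderiv (right_mem_Icc.2 hT₁0)
  have hlast : -L < D T₁ := hcon T₁ (right_mem_Icc.2 hT₁0)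
  -- (2em - φ) T₁ ≥ D 0 + L
  have hT₁ge : D 0 + L ≤ (2 * e * m - φ) * T₁ := by
    have h1 : (D 0 + L) / (2 * e * m - φ) ≤ T₁ := le_max_right _ _
    rw [div_le_iff₀ hγ] at h1
    linarith
  have : D T₁ ≤ D 0 - (2 * e * m - φ) * T₁ := hline
  linarith

/-- **Post-capture trigger decay.** If `u′ = eDu + f₂` with `e > 0`, and on `[s,T]` the receiver holds
the energy, `D ≤ −L` with `L > 0`, while `|f₂| ≤ φ`, then the trigger decays exponentially down to the
forcing floor: `|u(t)| ≤ |u(s)|·e^{−eL(t−s)} + φ/(eL)` for `t ∈ [s,T]` (fencing for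
`(u·e^{eL(t−s)})²`). [folklore] -/
theorem heteroclinicTriggerChain_forcedArc_trigger_decay {e φ L s T : ℝ} {D u f₂ : ℝ → ℝ} (he : 0 < e)
    (hL : 0 < L) (hu : ∀ t, HasDerivAt u (e * D t * u t + f₂ t) t)
    (hf₂ : ∀ t ∈ Icc s T, |f₂ t| ≤ φ) (hDL : ∀ t ∈ Icc s T, D t ≤ -L) :
    ∀ t ∈ Icc s T, |u t| ≤ |u s| * Real.exp (-(e * L * (t - s))) + φ / (e * L) := by
  intro t ht
  rcases lt_or_ge T s with hTs | hsT
  · exact absurd (ht.1.trans ht.2) (not_le.2 hTs)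
  have hφ : 0 ≤ φ := (abs_nonneg _).trans (hf₂ s ⟨le_rfl, hsT⟩)
  have heL : 0 < e * L := mul_pos he hL
  -- E(t) = exp(eL(t-s)), P = u·E, W = P²
  set E : ℝ → ℝ := fun r => Real.exp (e * L * (r - s)) with hE
  have hEpos : ∀ r, 0 < E r := fun r => Real.exp_pos _
  have hEd : ∀ r, HasDerivAt E (e * L * E r) r := by
    intro r
    have h := (((hasDerivAt_id r).sub_const s).const_mul (e * L)).exp
    refine h.congr_deriv ?_
    simp [hE]; ring
  have hW : ∀ r, HasDerivAt (fun r => (u r * E r) ^ 2)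
      (2 * E r ^ 2 * (e * (D r + L) * u r ^ 2 + u r * f₂ r)) r := by
    intro r
    have h1 : HasDerivAt (fun r => u r * E r) ((e * D r * u r + f₂ r) * E r + u r * (e * L * E r)) r :=
      (hu r).mul (hEd r)
    have h := h1.pow 2
    refine h.congr_deriv ?_
    push_cast
    ring
  -- the fence B_ε(r) = |u s| + ε + (φ + ε) (E r - 1)/(eL), compared through squares
  have hmain : ∀ ε : ℝ, 0 < ε →
      (u t * E t) ^ 2 ≤ (|u s| + ε + (φ + ε) * ((E t - 1) / (e * L))) ^ 2 := by
    intro ε hε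
    have hBd : ∀ r, HasDerivAt (fun r => |u s| + ε + (φ + ε) * ((E r - 1) / (e * L)))
        ((φ + ε) * E r) r := by
      intro r
      have h := (((hEd r).sub_const 1).div_const (e * L)).const_mul (φ + ε) |>.const_add (|u s| + ε)
      refine h.congr_deriv ?_
      field_simp
    have hBpos : ∀ r ∈ Icc s T, 0 < |u s| + ε + (φ + ε) * ((E r - 1) / (e * L)) := by
      intro r hr
      have h1 : 1 ≤ E r := by
        simp only [hE]; exact Real.one_le_exp (mul_nonneg heL.le (by linarith [hr.1]))
      have : 0 ≤ (φ + ε) * ((E r - 1) / (e * L)) := by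
        apply mul_nonneg (by linarith); exact div_nonneg (by linarith) heL.le
      have := abs_nonneg (u s)
      linarith
    have hB2 : ∀ r, HasDerivAt (fun r => (|u s| + ε + (φ + ε) * ((E r - 1) / (e * L))) ^ 2)
        (2 * (|u s| + ε + (φ + ε) * ((E r - 1) / (e * L))) * ((φ + ε) * E r)) r := by
      intro r
      have h := (hBd r).pow 2
      refine h.congr_deriv ?_
      push_cast; ring
    refine image_le_of_deriv_right_lt_deriv_boundary (a := s) (b := T)
      (f := fun r => (u r * E r) ^ 2)
      (fun r _ => (hW r).continuousAt.continuousWithinAt) (fun r _ => (hW r).hasDerivWithinAt)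
      ?_ hB2 ?_ ht
    · -- at r = s: E s = 1
      have hEs : E s = 1 := by simp [hE]
      simp only [hEs, mul_one, sub_self, zero_div, mul_zero, add_zero]
      have h0 : |u s| ≤ |u s| + ε := by linarith
      calc u s ^ 2 = |u s| ^ 2 := (sq_abs _).symm
        _ ≤ (|u s| + ε) ^ 2 := by
            exact pow_le_pow_left₀ (abs_nonneg _) h0 2
    · intro r hr hcontact
      have hr' : r ∈ Icc s T := Ico_subset_Icc_self hr
      set B : ℝ := |u s| + ε + (φ + ε) * ((E r - 1) / (e * L)) with hB
      have hBp : 0 < B := hBpos r hr'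
      -- contact: (u r · E r)² = B², so |u r| E r = B
      have habs : |u r| * E r = B := by
        have h1 : (|u r| * E r) ^ 2 = B ^ 2 := by
          rw [mul_pow, sq_abs, ← mul_pow]; exact hcontact
        have h2 : 0 ≤ |u r| * E r := mul_nonneg (abs_nonneg _) (hEpos r).le
        nlinarith [sq_nonneg (|u r| * E r - B), sq_nonneg (|u r| * E r + B)]
      -- W' ≤ 2 E² |u| φ = 2 E B φ < 2 B (φ + ε) E
      have hDr : D r + L ≤ 0 := by linarith [hDL r hr']
      have h1 : e * (D r + L) * u r ^ 2 ≤ 0 :=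
        mul_nonpos_of_nonpos_of_nonneg (mul_nonpos_of_nonneg_of_nonpos he.le hDr) (sq_nonneg _)
      have h2 : u r * f₂ r ≤ |u r| * φ := by
        calc u r * f₂ r ≤ |u r * f₂ r| := le_abs_self _
          _ = |u r| * |f₂ r| := abs_mul _ _
          _ ≤ |u r| * φ := mul_le_mul_of_nonneg_left (hf₂ r hr') (abs_nonneg _)
      have hE2 : 0 < E r ^ 2 := pow_pos (hEpos r) 2
      calc 2 * E r ^ 2 * (e * (D r + L) * u r ^ 2 + u r * f₂ r)
          ≤ 2 * E r ^ 2 * (|u r| * φ) := by nlinarith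
        _ = 2 * B * (φ * E r) := by rw [← habs]; ring
        _ < 2 * B * ((φ + ε) * E r) := by
            have : φ * E r < (φ + ε) * E r := by nlinarith [hEpos r]
            nlinarith
  -- take square roots, let ε → 0, divide by E t
  have hE1 : 1 ≤ E t := by
    simp only [hE]; exact Real.one_le_exp (mul_nonneg heL.le (by linarith [ht.1]))
  have hc : 0 ≤ (E t - 1) / (e * L) := div_nonneg (by linarith) heL.le
  have hroot : ∀ ε : ℝ, 0 < ε → |u t| * E t ≤ |u s| + ε + (φ + ε) * ((E t - 1) / (e * L)) := by
    intro ε hε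
    have hBp : 0 ≤ |u s| + ε + (φ + ε) * ((E t - 1) / (e * L)) := by
      have : 0 ≤ (φ + ε) * ((E t - 1) / (e * L)) := mul_nonneg (by linarith) hc
      have := abs_nonneg (u s); linarith
    have h := sq_le_sq.1 (hmain ε hε)
    rwa [abs_mul, abs_of_pos (hEpos t), abs_of_nonneg hBp] at h
  have hlim : |u t| * E t ≤ |u s| + φ * ((E t - 1) / (e * L)) := by
    refine le_of_forall_pos_le_add fun ε' hε' => ?_
    have hpos : 0 < 1 + (E t - 1) / (e * L) := by linarith
    have h := hroot (ε' / (1 + (E t - 1) / (e * L))) (div_pos hε' hpos)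
    have key : ε' / (1 + (E t - 1) / (e * L)) * (1 + (E t - 1) / (e * L)) = ε' :=
      div_mul_cancel₀ _ hpos.ne'
    calc |u t| * E t ≤ |u s| + ε' / (1 + (E t - 1) / (e * L)) +
          (φ + ε' / (1 + (E t - 1) / (e * L))) * ((E t - 1) / (e * L)) := h
      _ = |u s| + φ * ((E t - 1) / (e * L)) +
          ε' / (1 + (E t - 1) / (e * L)) * (1 + (E t - 1) / (e * L)) := by ring
      _ = |u s| + φ * ((E t - 1) / (e * L)) + ε' := by rw [key]
  have hsplit : φ * ((E t - 1) / (e * L)) = φ / (e * L) * E t - φ / (e * L) := by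
    field_simp
  have h2 : |u t| * E t ≤ |u s| + φ / (e * L) * E t := by
    have : 0 ≤ φ / (e * L) := div_nonneg hφ heL.le
    linarith
  have hEt := hEpos t
  have hinv : Real.exp (-(e * L * (t - s))) = (E t)⁻¹ := by rw [Real.exp_neg]
  rw [hinv]
  calc |u t| = |u t| * E t * (E t)⁻¹ := by field_simp
    _ ≤ (|u s| + φ / (e * L) * E t) * (E t)⁻¹ := mul_le_mul_of_nonneg_right h2 (inv_nonneg.2 hEt.le)
    _ = |u s| * (E t)⁻¹ + φ / (e * L) := by field_simp

/-- **Capture in the seeded two-shell truncation** (corollary; `g = e`, the complete-transfer tuning forced by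
the connection clause). For the lead's truncation `x′ = −eu² − βuv`, `u′ = exu − euy`, `y′ = eu² − e′v²`
(the fourth equation `v′ = βxu + e′yv` is not needed), the reduced variables `D = x − y`, `u` obey the
forced arc with `f₂ = 0` and `f₁ = −βuv + e′v²`; so if `|x − y|, |u| ≤ M` and `|v| ≤ V` on `[0,T]` the
forcing is `φ = βMV + e′V²`, and under the energy conditions of
`heteroclinicTriggerChain_forcedArc_capture` the receiver captures: `x − y ≤ −L` within
`(x(0) − y(0) + L)/(2em − φ)`. [folklore] -/
theorem heteroclinicTriggerChain_trunc_capture (e e' β : ℝ) (he : 0 < e) (he' : 0 ≤ e') (hβ : 0 ≤ β)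
    (x u y v : ℝ → ℝ)
    (hx : ∀ t, HasDerivAt x (-(e * u t ^ 2) - β * u t * v t) t)
    (hu : ∀ t, HasDerivAt u (e * x t * u t - e * u t * y t) t)
    (hy : ∀ t, HasDerivAt y (e * u t ^ 2 - e' * v t ^ 2) t)
    {T M V φ m L : ℝ} (hT : 0 ≤ T) (hφ : φ = β * M * V + e' * V ^ 2)
    (hDM : ∀ t ∈ Icc 0 T, |x t - y t| ≤ M) (huM : ∀ t ∈ Icc 0 T, |u t| ≤ M)
    (hvV : ∀ t ∈ Icc 0 T, |v t| ≤ V)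
    (hφm : φ < 2 * e * m) (hu0 : 2 * m + 6 * M * φ * T ≤ 2 * u 0 ^ 2)
    (hL : L ^ 2 + 2 * m + 6 * M * φ * T ≤ (x 0 - y 0) ^ 2 + 2 * u 0 ^ 2)
    (hTT : ((x 0 - y 0) + L) / (2 * e * m - φ) ≤ T) :
    ∃ t ∈ Icc 0 (max 0 (((x 0 - y 0) + L) / (2 * e * m - φ))), x t - y t ≤ -L := by
  have hM : 0 ≤ M := (abs_nonneg _).trans (huM 0 ⟨le_rfl, hT⟩)
  have hV : 0 ≤ V := (abs_nonneg _).trans (hvV 0 ⟨le_rfl, hT⟩)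
  have hD : ∀ t, HasDerivAt (fun t => x t - y t)
      (-(2 * e * u t ^ 2) + (-(β * u t * v t) + e' * v t ^ 2)) t := by
    intro t
    refine ((hx t).sub (hy t)).congr_deriv ?_
    ring
  have hu' : ∀ t, HasDerivAt u (e * (x t - y t) * u t + 0) t := by
    intro t
    refine (hu t).congr_deriv ?_
    ring
  have hf₁ : ∀ t ∈ Icc 0 T, |-(β * u t * v t) + e' * v t ^ 2| ≤ φ := by
    intro t ht
    have h1 : |β * u t * v t| ≤ β * M * V := by
      rw [abs_mul, abs_mul, abs_of_nonneg hβ]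
      exact mul_le_mul (mul_le_mul_of_nonneg_left (huM t ht) hβ) (hvV t ht) (abs_nonneg _)
        (mul_nonneg hβ hM)
    have h2 : |e' * v t ^ 2| ≤ e' * V ^ 2 := by
      rw [abs_mul, abs_of_nonneg he', abs_pow]
      exact mul_le_mul_of_nonneg_left (pow_le_pow_left₀ (abs_nonneg _) (hvV t ht) 2) he'
    calc |-(β * u t * v t) + e' * v t ^ 2| ≤ |-(β * u t * v t)| + |e' * v t ^ 2| := abs_add_le _ _
      _ = |β * u t * v t| + |e' * v t ^ 2| := by rw [abs_neg]
      _ ≤ φ := by rw [hφ]; linarith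
  have hφ0 : 0 ≤ φ := by rw [hφ]; positivity
  have hf₂ : ∀ t ∈ Icc 0 T, |(fun _ : ℝ => (0 : ℝ)) t| ≤ φ := fun t _ => by simpa using hφ0
  exact heteroclinicTriggerChain_forcedArc_capture (D := fun t => x t - y t) (f₂ := fun _ => 0) he hT hD
    hu' hf₁ hf₂ hDM huM hφm hu0 hL hTT

end Summit.NavierStokesRegularity.NavierStokesRegularity.Theorems

end
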